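import Summits.BirchSwinnertonDyer.Rank1Residual.Iwasawa.PrimeTorsionLineDecomposition
import HarnessLib

/-!
# Route (3e) SELMER COMPANION, XXIX: two lines of prime order with different eigenvalues
# (generic finite-group algebra for the opposite-twist kill kind; class X11a = N7; cell
# `b2b-bsdres`, unit `b2b-bsdres-x11a`, gen 30)

HONEST FRAMING (run/shared/lean/b2b/bsd-rank1-residual/, verbatim in every file): the goal of the
cell is to DELETE the COMBINATION-SHAPED residual classes of the Birch–Swinnerton-Dyer formula for
ALL analytic-rank `≤ 1` elliptic curves over `ℚ` — "full BSD formula for every rank `≤ 1` curve in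
class `C`" assembled STRICTLY from published theorems — so that the rank-`≤ 1` remainder becomes
exactly the CONSTRUCTION-SHAPED classes, which are TYPED (missing-input `Prop`s), NOT attempted.
This is not "finishing BSD". CLASS-OWNERS.md: research routes; NO CLAIM BEYOND STATED CLASSES.
THEOREMS ONLY; nothing booked; no label moves.

## What this file proves

Elementary facts about two `p`-torsion elements `L₁, L₂` (`p` prime) of an additive group, used by
file XXX (`X11a/SelmerCompanionOppositeTwist.lean`) for the two TATE LINES of `p`-congruent curves
with multiplicative reduction of opposite twist type:

* `not_mem_zmultiples_of_eigenvalues` — if an additive endomorphism `s` (an element of the Galois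
  group) acts on `L₁ ≠ 0` by the scalar `c₁` and on `L₂` by `c₂` with `p ∤ c₁ − c₂`, then
  `L₁ ∉ ℤL₂` (eigenvectors for different eigenvalues are independent);
* `eq_zero_of_mem_zmultiples_of_mem_zmultiples` — if `L₁ ∉ ℤL₂` (`L₁` of order `p`), then
  `ℤL₁ ∩ ℤL₂ = 0`;
* `nsmul_sub_mem_zmultiples`, `eq_of_sub_eq_add_of_lines` — bookkeeping for splitting an identity along `ℤL₁ ⊕ ℤL₂`.

Generic algebra (Silverman *AEC* III.6.4(b) context: `E[p] ≅ (ℤ/p)²`); no curve appears.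
References: file XXX; HOME/b2b-bsdres-x11a/REPORT-g30.md §3(a). [folklore]
-/

set_option autoImplicit false

universe u

namespace Summit.BirchSwinnertonDyer.Rank1Residual.X11a.SelmerCompanion.TwoLines

open Summit.BirchSwinnertonDyer.Rank1Residual.Iwasawa

variable {M : Type u} [AddCommGroup M] {p : ℕ} [hp : Fact p.Prime]

omit hp in
/-- A `p`-torsion element `x = a • L` with `p ∣ a` is zero. [folklore] -/
theorem zsmul_eq_zero_of_dvd {L : M} (hL : p • L = 0) {a : ℤ} (ha : (p : ℤ) ∣ a) : a • L = 0 := by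
  obtain ⟨b, rfl⟩ := ha
  rw [mul_comm, mul_zsmul, natCast_zsmul, hL, zsmul_zero]

/-- **Eigenvectors for different eigenvalues mod `p` are independent.** Let `s : M →+ M` act on the
non-zero `p`-torsion element `L₁` by the scalar `c₁` and on the `p`-torsion element `L₂` by `c₂`,
with `p ∤ c₁ − c₂`. Then `L₁ ∉ ℤ L₂`. (If `L₁ = a L₂` then `c₁ a L₂ = s L₁ = a c₂ L₂`, so
`p ∣ a (c₁ − c₂)`, `p ∣ a`, `L₁ = 0`.) [folklore] -/
theorem not_mem_zmultiples_of_eigenvalues (s : M →+ M) {L₁ L₂ : M}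
    (hL₂ : p • L₂ = 0) (hL₁0 : L₁ ≠ 0) {c₁ c₂ : ℤ} (hs₁ : s L₁ = c₁ • L₁) (hs₂ : s L₂ = c₂ • L₂)
    (hc : ¬ (p : ℤ) ∣ c₁ - c₂) : L₁ ∉ AddSubgroup.zmultiples L₂ := by
  intro hmem
  obtain ⟨a, ha⟩ := AddSubgroup.mem_zmultiples_iff.mp hmem
  -- `(a (c₁ - c₂)) • L₂ = 0`
  have h1 : (a * (c₁ - c₂)) • L₂ = 0 := by
    have e1 : s L₁ = (c₁ * a) • L₂ := by rw [hs₁, ← ha, smul_smul]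
    have e2 : s L₁ = (a * c₂) • L₂ := by rw [← ha, map_zsmul, hs₂, smul_smul]
    rw [mul_sub, sub_smul, mul_comm a c₁, ← e1, e2, sub_self]
  -- hence `p ∣ a (c₁ - c₂)`, so `p ∣ a`
  have hp' : Prime (p : ℤ) := Nat.prime_iff_prime_int.mp hp.out
  by_cases hL₂0 : L₂ = 0
  · exact hL₁0 (by rw [← ha, hL₂0, zsmul_zero])
  have hord : addOrderOf L₂ = p := addOrderOf_eq_prime hL₂ hL₂0
  have hdvd : (p : ℤ) ∣ a * (c₁ - c₂) := by
    have := (addOrderOf_dvd_iff_zsmul_eq_zero).mpr h1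
    rwa [hord] at this
  rcases hp'.dvd_or_dvd hdvd with h | h
  · exact hL₁0 (by rw [← ha]; exact zsmul_eq_zero_of_dvd hL₂ h)
  · exact hc h

/-- **`ℤL₁ ∩ ℤL₂ = 0` when `L₁ ∉ ℤL₂`** (`L₁` of prime order `p`): an element `x = a L₁` of `ℤL₂`
with `p ∤ a` would put `L₁` into `ℤL₂` (invert `a` mod `p`, tree
`Iwasawa.PrimeTorsionLine.mem_of_zsmul_mem`). [folklore] -/
theorem eq_zero_of_mem_zmultiples_of_mem_zmultiples {L₁ L₂ : M} (hL₁ : p • L₁ = 0)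
    (h12 : L₁ ∉ AddSubgroup.zmultiples L₂) {x : M} (hx₁ : x ∈ AddSubgroup.zmultiples L₁)
    (hx₂ : x ∈ AddSubgroup.zmultiples L₂) : x = 0 := by
  obtain ⟨a, rfl⟩ := AddSubgroup.mem_zmultiples_iff.mp hx₁
  by_cases ha : (p : ℤ) ∣ a
  · exact zsmul_eq_zero_of_dvd hL₁ ha
  · exact absurd (PrimeTorsionLine.mem_of_zsmul_mem (AddSubgroup.zmultiples L₂) hL₁ ha hx₂) h12

/-- Bookkeeping: if `u ∈ ℤL` then `j • (u − L) ∈ ℤL` (`j : ℕ`). [folklore] -/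
theorem nsmul_sub_mem_zmultiples {L u : M} (hu : u ∈ AddSubgroup.zmultiples L) (j : ℕ) :
    j • (u - L) ∈ AddSubgroup.zmultiples L :=
  AddSubgroup.nsmul_mem _ (AddSubgroup.sub_mem _ hu (AddSubgroup.mem_zmultiples L)) j

/-- **Splitting an identity along `M[p] = ℤL₁ ⊕ ℤL₂`.** If `x₂ − x₁ = y₁ + y₂` with
`x₁, y₁ ∈ ℤL₁` and `x₂, y₂ ∈ ℤL₂`, and `ℤL₁ ∩ ℤL₂ = 0` (`L₁ ∉ ℤL₂`, `L₁` of prime order), then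
`x₂ = y₂`. [folklore] -/
theorem eq_of_sub_eq_add_of_lines {L₁ L₂ : M} (hL₁ : p • L₁ = 0)
    (h12 : L₁ ∉ AddSubgroup.zmultiples L₂) {x₁ x₂ y₁ y₂ : M}
    (hx₁ : x₁ ∈ AddSubgroup.zmultiples L₁) (hx₂ : x₂ ∈ AddSubgroup.zmultiples L₂)
    (hy₁ : y₁ ∈ AddSubgroup.zmultiples L₁) (hy₂ : y₂ ∈ AddSubgroup.zmultiples L₂)
    (h : x₂ - x₁ = y₁ + y₂) : x₂ = y₂ := by
  -- `x₂ - y₂ = x₁ + y₁` lies in both lines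
  have h' : x₂ - y₂ = x₁ + y₁ := by rw [sub_eq_iff_eq_add] at h; rw [h]; abel
  have hz : x₂ - y₂ = 0 :=
    eq_zero_of_mem_zmultiples_of_mem_zmultiples hL₁ h12
      (by rw [h']; exact AddSubgroup.add_mem _ hx₁ hy₁) (AddSubgroup.sub_mem _ hx₂ hy₂)
  exact sub_eq_zero.mp hz

end Summit.BirchSwinnertonDyer.Rank1Residual.X11a.SelmerCompanion.TwoLines
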